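import Mathlib
import HarnessLib
import Summits.Ventures.LatticeQCDFlow.Scaling.AutoregressiveGaugeHeatBathColdStartMSE
import Summits.Ventures.LatticeQCDFlow.Scaling.AutoregressiveGaugeColdEscapeDimension

/-!
# LatticeQCDFlow / Scaling — the cold start at second order, BY DIMENSION: on `(ℤ/L)²` the optimal exact heat bath
# pays at most `(2(M/m)² − M/m)·δf²/N²` for every `L`; in every `d` a farm of cold-started replicas of length `N`
# along an optimal structure is no better than `|δf|/(1 + N·θ₁^s)`, `(2(d−1)−1)s ≥ k_min(d, L)`

HONEST FRAMING: exact (Metropolis-corrected) sampling algorithms for lattice gauge theory;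
figures of merit are autocorrelation/cost numbers at stated couplings and volumes; no
continuum-physics claim.

Venture `LatticeQCDFlow` (cell pub-lqcd), topic `Scaling`, FANOUT row 30 (lean-1, GEN-32) — OUR WORK, composing this
generation's `AutoregressiveGaugeHeatBathColdStartMSE` with GEN-28's dimension dichotomy
`AutoregressiveGaugeColdEscapeDimension` (`m/M ≤ A` on `(ℤ/L)²` with `k = 1`; `A ≤ θ₁^s`, `θ₁ = c₂/(c·M)`,
`(2(d−1)−1)s ≥ k_min(d,L) = (d−1)(d−2)/2·L^d + (d−1)` along optimal structures in every `d`).  Setting of the heat-bath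
files; `δf = f(cold) − π f`, `MSE_μ(N)` the mean-square error of the time average on path space, `N ≥ 1`.

* **`two_dim_optimal_coldStart_mse_le`** — `d = 2`, `k = 1`, `w(1) = M`: for EVERY `L` and every bounded observable,
  `MSE_cold(N) ≤ MSE_π(N) + (2(M/m)² − M/m)·δf²/N²` — on the two-dimensional torus the cold start of the optimal exact
  sampler is an `L`-INDEPENDENT second-order correction;
* **`optimal_coldStart_replicas_floor`** — every `d`, optimal structure: there is `s` with `k_min ≤ (2(d−1)−1)s` such
  that the grand mean of any number of (arbitrarily dependent, square-integrable) replicas with the cold-started mean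
  obeys `E (Ȳ − π f)² ≥ δf²/(1 + N·θ₁^s)²`; hence (**`optimal_replicas_length_necessary`**) accuracy `ε` forces
  `(|δf|/ε − 1)·(θ₁^s)⁻¹ ≤ N` PER REPLICA — with `θ₁ < 1` (non-constant weight) exponentially long in `L^d` for
  `d ≥ 3` (`d = 3`: `3s ≥ L³ + 2`), whatever the size of the farm.

NOT CLAIMED: `θ₁ < 1` (true iff `w` is not Haar-a.e. constant, GEN-26); the equilibrium error `MSE_π(N)` itself; the
all-closing conditioner by dimension.  No `def`, no `sorry`, nothing cited as a fact beyond the tree.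
-/

noncomputable section

namespace Summit.Ventures.LatticeQCDFlow.Theory2.Autoregressive

open MeasureTheory ProbabilityTheory Function Finset
open scoped ENNReal
open Literature.MathematicalPhysics.QuantumFieldTheory Literature.MathematicalPhysics.QuantumLattice
open Summit.Ventures.LatticeQCDFlow.Exactness Summit.Ventures.LatticeQCDFlow.Scoring

variable {d L : ℕ} [NeZero L] {G : Type*} [Group G] [TopologicalSpace G] [IsTopologicalGroup G]
  [CompactSpace G] [SecondCountableTopology G] [MeasurableSpace G] [BorelSpace G]

/-- `x ↦ 2x² − x` is monotone on `x + y ≥ 1/2`: `x ≤ y`, `1/2 ≤ x + y` ⇒ `2x² − x ≤ 2y² − y`. [ours, algebra] -/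
theorem two_sq_sub_mono {x y : ℝ} (hxy : x ≤ y) (hs : 1 / 2 ≤ x + y) : 2 * x ^ 2 - x ≤ 2 * y ^ 2 - y := by
  nlinarith [mul_nonneg (sub_nonneg.2 hxy) (by linarith : (0:ℝ) ≤ 2 * (x + y) - 1)]

/-- **`d = 2`, OPTIMAL (`k = 1`): `MSE_cold(N) ≤ MSE_π(N) + (2(M/m)² − M/m)·δf²/N²` FOR EVERY `L`.** [ours] -/
theorem two_dim_optimal_coldStart_mse_le [MeasurableSingletonClass G] (hL : 2 ≤ L) {w : G → ℝ} (hw : Continuous w) {m M : ℝ} (hm0 : 0 < m)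
    (hm : ∀ g, m ≤ w g) (hM : ∀ g, w g ≤ M) (hw1 : w 1 = M)
    (B : Finset (Plaquette 2 L)) (t : Plaquette 2 L → Edge 2 L)
    (ht : ∀ p ∈ B, t p ∈ ({(p.1, p.2.1.1), (p.1.shift p.2.1.1, p.2.1.2),
        (p.1.shift p.2.1.2, p.2.1.1), (p.1, p.2.1.2)} : Finset (Edge 2 L)))
    (rank : Plaquette 2 L → ℕ)
    (hrank : ∀ p ∈ B, ∀ p' ∈ B, p ≠ p' → t p ∈ ({(p'.1, p'.2.1.1), (p'.1.shift p'.2.1.1, p'.2.1.2),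
        (p'.1.shift p'.2.1.2, p'.2.1.1), (p'.1, p'.2.1.2)} : Finset (Edge 2 L)) → rank p < rank p')
    (π q : Measure (GaugeConfig 2 L G)) [IsProbabilityMeasure π] [IsProbabilityMeasure q]
    (hπ : π = (Measure.pi fun _ : Edge 2 L => haarProbability G).withDensity fun U =>
      ENNReal.ofReal ((∏ p : Plaquette 2 L, w (plaquetteHolonomy U p.1 p.2.1.1 p.2.1.2)) /
        ∫ V, ∏ p : Plaquette 2 L, w (plaquetteHolonomy V p.1 p.2.1.1 p.2.1.2)
          ∂(Measure.pi fun _ : Edge 2 L => haarProbability G)))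
    (hq : q = (Measure.pi fun _ : Edge 2 L => haarProbability G).withDensity fun U =>
      ENNReal.ofReal ((∏ p ∈ B, w (plaquetteHolonomy U p.1 p.2.1.1 p.2.1.2)) /
        ∫ V, ∏ p ∈ B, w (plaquetteHolonomy V p.1 p.2.1.1 p.2.1.2)
          ∂(Measure.pi fun _ : Edge 2 L => haarProbability G)))
    (hopt : (Finset.univ \ B).card = 1)
    [Fact (Measurable (fun U =>
        ((∫ V, ∏ p : Plaquette 2 L, w (plaquetteHolonomy V p.1 p.2.1.1 p.2.1.2)
            ∂(Measure.pi fun _ : Edge 2 L => haarProbability G)) /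
          ((∫ V, ∏ p ∈ B, w (plaquetteHolonomy V p.1 p.2.1.1 p.2.1.2)
            ∂(Measure.pi fun _ : Edge 2 L => haarProbability G)) *
            ∏ p ∈ Finset.univ \ B, w (plaquetteHolonomy U p.1 p.2.1.1 p.2.1.2)))⁻¹))]
    {f : GaugeConfig 2 L G → ℝ} (hf : Measurable f) {Cf : ℝ} (hCf : ∀ U, |f U| ≤ Cf) {N : ℕ} (hN : N ≠ 0) :
    ∫ x, ((∑ i ∈ Finset.range N, f (x i)) / N - ∫ U, f U ∂π) ^ 2 ∂(Kernel.trajMeasure (X := fun _ : ℕ => GaugeConfig 2 L G) (Measure.dirac (fun _ : Edge 2 L => (1 : G)))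
        (fun n : ℕ => (indepMH q (fun U =>
        ((∫ V, ∏ p : Plaquette 2 L, w (plaquetteHolonomy V p.1 p.2.1.1 p.2.1.2)
            ∂(Measure.pi fun _ : Edge 2 L => haarProbability G)) /
          ((∫ V, ∏ p ∈ B, w (plaquetteHolonomy V p.1 p.2.1.1 p.2.1.2)
            ∂(Measure.pi fun _ : Edge 2 L => haarProbability G)) *
            ∏ p ∈ Finset.univ \ B, w (plaquetteHolonomy U p.1 p.2.1.1 p.2.1.2)))⁻¹)).comap
          (fun h : (i : ↥(Finset.Iic n)) → GaugeConfig 2 L G => h ⟨n, Finset.mem_Iic.2 le_rfl⟩)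
          (measurable_pi_apply _))) ≤
      ∫ x, ((∑ i ∈ Finset.range N, f (x i)) / N - ∫ U, f U ∂π) ^ 2 ∂(Kernel.trajMeasure (X := fun _ : ℕ => GaugeConfig 2 L G) π
        (fun n : ℕ => (indepMH q (fun U =>
        ((∫ V, ∏ p : Plaquette 2 L, w (plaquetteHolonomy V p.1 p.2.1.1 p.2.1.2)
            ∂(Measure.pi fun _ : Edge 2 L => haarProbability G)) /
          ((∫ V, ∏ p ∈ B, w (plaquetteHolonomy V p.1 p.2.1.1 p.2.1.2)
            ∂(Measure.pi fun _ : Edge 2 L => haarProbability G)) *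
            ∏ p ∈ Finset.univ \ B, w (plaquetteHolonomy U p.1 p.2.1.1 p.2.1.2)))⁻¹)).comap
          (fun h : (i : ↥(Finset.Iic n)) → GaugeConfig 2 L G => h ⟨n, Finset.mem_Iic.2 le_rfl⟩)
          (measurable_pi_apply _))) +
        (2 * (M / m) ^ 2 - M / m) * (f (fun _ : Edge 2 L => (1 : G)) - ∫ U, f U ∂π) ^ 2 / (N : ℝ) ^ 2 := by
  have hw0 : ∀ g, 0 < w g := fun g => hm0.trans_le (hm g)
  have hMpos : 0 < M := (hw0 1).trans_le (hM 1)
  have hNpos : (0 : ℝ) < N := by exact_mod_cast Nat.pos_of_ne_zero hN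
  have hge := two_dim_heatBath_coldRate_ge hL hw hm0 hm hM B t ht rank hrank hopt
  have hmM : 0 < m / M := div_pos hm0 hMpos
  have hmM1 : m / M ≤ 1 := (div_le_one hMpos).2 ((hm 1).trans (hM 1))
  have hApos : 0 < ((∫ V, ∏ p : Plaquette 2 L, w (plaquetteHolonomy V p.1 p.2.1.1 p.2.1.2)
            ∂(Measure.pi fun _ : Edge 2 L => haarProbability G)) /
        ((∫ g, w g ∂(haarProbability G)) ^ B.card * M ^ (Finset.univ \ B).card)) := hmM.trans_le hge
  have hinv : (((∫ V, ∏ p : Plaquette 2 L, w (plaquetteHolonomy V p.1 p.2.1.1 p.2.1.2)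
            ∂(Measure.pi fun _ : Edge 2 L => haarProbability G)) /
        ((∫ g, w g ∂(haarProbability G)) ^ B.card * M ^ (Finset.univ \ B).card)))⁻¹ ≤ M / m := by
    rw [inv_le_comm₀ hApos (div_pos hMpos hm0), inv_div]
    exact hge
  have hone : 1 ≤ M / m := by rw [← inv_div]; exact one_le_inv_iff₀.2 ⟨hmM, hmM1⟩
  have hmono := two_sq_sub_mono hinv (by linarith [inv_nonneg.2 hApos.le])
  have h := heatBath_coldStart_mse_le hL hw hm0 hm hM hw1 B t ht rank hrank π q hπ hq hf hCf hN
  have hδ : 0 ≤ (f (fun _ : Edge 2 L => (1 : G)) - ∫ U, f U ∂π) ^ 2 / (N : ℝ) ^ 2 := by positivity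
  have hstep := mul_le_mul_of_nonneg_right hmono hδ
  calc _ ≤ _ := h
    _ ≤ _ := by
      rw [mul_div_assoc, mul_div_assoc]
      linarith [hstep]

/-- **EVERY `d`, OPTIMAL STRUCTURE: A FARM OF COLD-STARTED REPLICAS IS NO BETTER THAN `|δf|/(1 + N·θ₁^s)`**:
`∃ s`, `k_min(d,L) ≤ (2(d−1)−1)s`, and for any number of arbitrarily dependent square-integrable replicas with the
cold-started mean, `E (Ȳ − π f)² ≥ δf²/(1 + N·θ₁^s)²`, `θ₁ = c₂/(c·M)`. [ours] -/
theorem optimal_coldStart_replicas_floor (hL : 2 ≤ L) {w : G → ℝ} (hw : Continuous w) {m M : ℝ} (hm0 : 0 < m)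
    (hm : ∀ g, m ≤ w g) (hM : ∀ g, w g ≤ M) (hw1 : w 1 = M)
    (B : Finset (Plaquette d L)) (t : Plaquette d L → Edge d L)
    (ht : ∀ p ∈ B, t p ∈ ({(p.1, p.2.1.1), (p.1.shift p.2.1.1, p.2.1.2),
        (p.1.shift p.2.1.2, p.2.1.1), (p.1, p.2.1.2)} : Finset (Edge d L)))
    (rank : Plaquette d L → ℕ)
    (hrank : ∀ p ∈ B, ∀ p' ∈ B, p ≠ p' → t p ∈ ({(p'.1, p'.2.1.1), (p'.1.shift p'.2.1.1, p'.2.1.2),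
        (p'.1.shift p'.2.1.2, p'.2.1.1), (p'.1, p'.2.1.2)} : Finset (Edge d L)) → rank p < rank p')
    (π q : Measure (GaugeConfig d L G)) [IsProbabilityMeasure π] [IsProbabilityMeasure q]
    (hπ : π = (Measure.pi fun _ : Edge d L => haarProbability G).withDensity fun U =>
      ENNReal.ofReal ((∏ p : Plaquette d L, w (plaquetteHolonomy U p.1 p.2.1.1 p.2.1.2)) /
        ∫ V, ∏ p : Plaquette d L, w (plaquetteHolonomy V p.1 p.2.1.1 p.2.1.2)
          ∂(Measure.pi fun _ : Edge d L => haarProbability G)))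
    (hq : q = (Measure.pi fun _ : Edge d L => haarProbability G).withDensity fun U =>
      ENNReal.ofReal ((∏ p ∈ B, w (plaquetteHolonomy U p.1 p.2.1.1 p.2.1.2)) /
        ∫ V, ∏ p ∈ B, w (plaquetteHolonomy V p.1 p.2.1.1 p.2.1.2)
          ∂(Measure.pi fun _ : Edge d L => haarProbability G)))
    (hopt : (Finset.univ \ B).card = (d - 1) * (d - 2) / 2 * L ^ d + (d - 1))
    {Ω' : Type*} {mΩ' : MeasurableSpace Ω'} {μ : Measure Ω'} [IsProbabilityMeasure μ] {Y : ℕ → Ω' → ℝ} {R : ℕ}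
    (hR : R ≠ 0) (hY : ∀ r < R, MemLp (Y r) 2 μ) {f : GaugeConfig d L G → ℝ} {N : ℕ} (hN : N ≠ 0)
    (hmean : ∀ r < R, μ[Y r] = ∫ U, f U ∂π + (f (fun _ : Edge d L => (1 : G)) - ∫ U, f U ∂π) *
      (∑ n ∈ Finset.range N, (1 - ((∫ V, ∏ p : Plaquette d L, w (plaquetteHolonomy V p.1 p.2.1.1 p.2.1.2)
            ∂(Measure.pi fun _ : Edge d L => haarProbability G)) /
        ((∫ g, w g ∂(haarProbability G)) ^ B.card * M ^ (Finset.univ \ B).card))) ^ n) / N) :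
    ∃ s : ℕ, (d - 1) * (d - 2) / 2 * L ^ d + (d - 1) ≤ (2 * (d - 1) - 1) * s ∧
      (f (fun _ : Edge d L => (1 : G)) - ∫ U, f U ∂π) ^ 2 / (1 + N * ((∫ h, w h ^ 2 ∂(haarProbability G)) / ((∫ g, w g ∂(haarProbability G)) * M)) ^ s) ^ 2 ≤
        ∫ ω, (replicaMean Y R ω - ∫ U, f U ∂π) ^ 2 ∂μ := by
  have hw0 : ∀ g, 0 < w g := fun g => hm0.trans_le (hm g)
  have hMpos : 0 < M := (hw0 1).trans_le (hM 1)
  have hNpos : (0 : ℝ) < N := by exact_mod_cast Nat.pos_of_ne_zero hN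
  obtain ⟨s, hs, hAle⟩ := optimal_heatBath_coldRate_le_pow hL hw hm0 hm hM B t ht rank hrank hopt
  obtain ⟨hAge, -⟩ := heatBath_coldRate_bounds hL hw hm0 hm hM B t ht rank hrank
  have hApos : 0 < ((∫ V, ∏ p : Plaquette d L, w (plaquetteHolonomy V p.1 p.2.1.1 p.2.1.2)
            ∂(Measure.pi fun _ : Edge d L => haarProbability G)) /
        ((∫ g, w g ∂(haarProbability G)) ^ B.card * M ^ (Finset.univ \ B).card)) := (pow_pos (div_pos hm0 hMpos) _).trans_le hAge
  refine ⟨s, hs, ?_⟩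
  have hfloor := heatBath_coldStart_replicas_floor hL hw hm0 hm hM hw1 B t ht rank hrank π q hπ hq hR hY hN hmean
  refine le_trans ?_ hfloor
  have hD1 : 0 < 1 + N * ((∫ V, ∏ p : Plaquette d L, w (plaquetteHolonomy V p.1 p.2.1.1 p.2.1.2)
            ∂(Measure.pi fun _ : Edge d L => haarProbability G)) /
        ((∫ g, w g ∂(haarProbability G)) ^ B.card * M ^ (Finset.univ \ B).card)) := by
    have := mul_nonneg hNpos.le hApos.le
    linarith
  have hD2 : 1 + N * ((∫ V, ∏ p : Plaquette d L, w (plaquetteHolonomy V p.1 p.2.1.1 p.2.1.2)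
            ∂(Measure.pi fun _ : Edge d L => haarProbability G)) /
        ((∫ g, w g ∂(haarProbability G)) ^ B.card * M ^ (Finset.univ \ B).card)) ≤
      1 + N * ((∫ h, w h ^ 2 ∂(haarProbability G)) / ((∫ g, w g ∂(haarProbability G)) * M)) ^ s := by
    have := mul_le_mul_of_nonneg_left hAle hNpos.le
    linarith
  exact div_le_div_of_nonneg_left (sq_nonneg _) (pow_pos hD1 2) (pow_le_pow_left₀ hD1.le hD2 2)

/-- **EVERY REPLICA MUST ITSELF OUTLIVE `θ₁^{−s}`**: along an optimal structure, grand-mean accuracy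
`E (Ȳ − π f)² ≤ ε²` (`ε > 0`) forces `(|δf|/ε − 1)·(θ₁^s)⁻¹ ≤ N` with `k_min(d,L) ≤ (2(d−1)−1)s` — in `d = 3`,
`3s ≥ L³ + 2`. [ours] -/
theorem optimal_replicas_length_necessary (hL : 2 ≤ L) {w : G → ℝ} (hw : Continuous w) {m M : ℝ} (hm0 : 0 < m)
    (hm : ∀ g, m ≤ w g) (hM : ∀ g, w g ≤ M) (hw1 : w 1 = M)
    (B : Finset (Plaquette d L)) (t : Plaquette d L → Edge d L)
    (ht : ∀ p ∈ B, t p ∈ ({(p.1, p.2.1.1), (p.1.shift p.2.1.1, p.2.1.2),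
        (p.1.shift p.2.1.2, p.2.1.1), (p.1, p.2.1.2)} : Finset (Edge d L)))
    (rank : Plaquette d L → ℕ)
    (hrank : ∀ p ∈ B, ∀ p' ∈ B, p ≠ p' → t p ∈ ({(p'.1, p'.2.1.1), (p'.1.shift p'.2.1.1, p'.2.1.2),
        (p'.1.shift p'.2.1.2, p'.2.1.1), (p'.1, p'.2.1.2)} : Finset (Edge d L)) → rank p < rank p')
    (π q : Measure (GaugeConfig d L G)) [IsProbabilityMeasure π] [IsProbabilityMeasure q]
    (hπ : π = (Measure.pi fun _ : Edge d L => haarProbability G).withDensity fun U =>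
      ENNReal.ofReal ((∏ p : Plaquette d L, w (plaquetteHolonomy U p.1 p.2.1.1 p.2.1.2)) /
        ∫ V, ∏ p : Plaquette d L, w (plaquetteHolonomy V p.1 p.2.1.1 p.2.1.2)
          ∂(Measure.pi fun _ : Edge d L => haarProbability G)))
    (hq : q = (Measure.pi fun _ : Edge d L => haarProbability G).withDensity fun U =>
      ENNReal.ofReal ((∏ p ∈ B, w (plaquetteHolonomy U p.1 p.2.1.1 p.2.1.2)) /
        ∫ V, ∏ p ∈ B, w (plaquetteHolonomy V p.1 p.2.1.1 p.2.1.2)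
          ∂(Measure.pi fun _ : Edge d L => haarProbability G)))
    (hopt : (Finset.univ \ B).card = (d - 1) * (d - 2) / 2 * L ^ d + (d - 1))
    {Ω' : Type*} {mΩ' : MeasurableSpace Ω'} {μ : Measure Ω'} [IsProbabilityMeasure μ] {Y : ℕ → Ω' → ℝ} {R : ℕ}
    (hR : R ≠ 0) (hY : ∀ r < R, MemLp (Y r) 2 μ) {f : GaugeConfig d L G → ℝ} {N : ℕ} (hN : N ≠ 0)
    (hmean : ∀ r < R, μ[Y r] = ∫ U, f U ∂π + (f (fun _ : Edge d L => (1 : G)) - ∫ U, f U ∂π) *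
      (∑ n ∈ Finset.range N, (1 - ((∫ V, ∏ p : Plaquette d L, w (plaquetteHolonomy V p.1 p.2.1.1 p.2.1.2)
            ∂(Measure.pi fun _ : Edge d L => haarProbability G)) /
        ((∫ g, w g ∂(haarProbability G)) ^ B.card * M ^ (Finset.univ \ B).card))) ^ n) / N)
    {ε : ℝ} (hε : 0 < ε) (hacc : ∫ ω, (replicaMean Y R ω - ∫ U, f U ∂π) ^ 2 ∂μ ≤ ε ^ 2) :
    ∃ s : ℕ, (d - 1) * (d - 2) / 2 * L ^ d + (d - 1) ≤ (2 * (d - 1) - 1) * s ∧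
      (|f (fun _ : Edge d L => (1 : G)) - ∫ U, f U ∂π| / ε - 1) * (((∫ h, w h ^ 2 ∂(haarProbability G)) / ((∫ g, w g ∂(haarProbability G)) * M)) ^ s)⁻¹ ≤ N := by
  have hw0 : ∀ g, 0 < w g := fun g => hm0.trans_le (hm g)
  have hMpos : 0 < M := (hw0 1).trans_le (hM 1)
  have hNpos : (0 : ℝ) < N := by exact_mod_cast Nat.pos_of_ne_zero hN
  obtain ⟨s, hs, hfl⟩ := optimal_coldStart_replicas_floor hL hw hm0 hm hM hw1 B t ht rank hrank π q hπ hq hopt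
    hR hY hN hmean
  obtain ⟨s', hs', hAle⟩ := optimal_heatBath_coldRate_le_pow hL hw hm0 hm hM B t ht rank hrank hopt
  obtain ⟨hAge, -⟩ := heatBath_coldRate_bounds hL hw hm0 hm hM B t ht rank hrank
  have hApos : 0 < ((∫ V, ∏ p : Plaquette d L, w (plaquetteHolonomy V p.1 p.2.1.1 p.2.1.2)
            ∂(Measure.pi fun _ : Edge d L => haarProbability G)) /
        ((∫ g, w g ∂(haarProbability G)) ^ B.card * M ^ (Finset.univ \ B).card)) := (pow_pos (div_pos hm0 hMpos) _).trans_le hAge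
  refine ⟨s, hs, ?_⟩
  set θ := ((∫ h, w h ^ 2 ∂(haarProbability G)) / ((∫ g, w g ∂(haarProbability G)) * M)) ^ s with hθ
  set δ := f (fun _ : Edge d L => (1 : G)) - ∫ U, f U ∂π with hδ
  -- `θ > 0`: the floor with `θ` was derived from `A ≤ θ₁^{s}`; we only need `0 < 1 + N θ`, which holds as `θ ≥ 0`
  have hθ0 : 0 ≤ θ := by
    rw [hθ]
    exact pow_nonneg (div_nonneg (integral_nonneg fun h => sq_nonneg _)
      (mul_nonneg (integral_nonneg fun g => (hw0 g).le) hMpos.le)) s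
  have hD : 0 < 1 + N * θ := by
    have := mul_nonneg hNpos.le hθ0
    linarith
  have h1 : δ ^ 2 / (1 + N * θ) ^ 2 ≤ ε ^ 2 := hfl.trans hacc
  have h2 : |δ| / (1 + N * θ) ≤ ε := by
    have h3 : (|δ| / (1 + N * θ)) ^ 2 ≤ ε ^ 2 := by rwa [div_pow, sq_abs]
    exact (pow_le_pow_iff_left₀ (by positivity) hε.le two_ne_zero).1 h3
  rw [div_le_iff₀ hD] at h2
  by_cases hθpos : 0 < θ
  · rw [mul_comm, ← div_eq_inv_mul, div_le_iff₀ hθpos, sub_le_iff_le_add, div_le_iff₀ hε]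
    nlinarith [h2]
  · have hθz : θ = 0 := le_antisymm (not_lt.1 hθpos) hθ0
    rw [hθz, inv_zero, mul_zero]
    exact hNpos.le

end Summit.Ventures.LatticeQCDFlow.Theory2.Autoregressive

end
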